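import Mathlib.Analysis.SpecialFunctions.Trigonometric.ArctanDeriv
import Mathlib.Analysis.SpecialFunctions.Integrals.Basic
import Mathlib.MeasureTheory.Integral.IntervalIntegral.FundThmCalculus
import Mathlib.MeasureTheory.Integral.IntervalIntegral.IntegrationByParts
import HarnessLib

/-!
# Wirtinger's inequality with Dirichlet ends: `∫₀^π y² ≤ ∫₀^π y′²` for `y(0) = y(π) = 0`, `y′ ∈ L²`

Topic `Literature/Analysis/Fourier` (companion of `Wirtinger.lean`, the periodic zero-mean form, and of the `C¹(ℝ)` interval form
`Literature.Analysis.FluidPDE.Elgindi.wirtinger_dirichlet`). Hardy–Littlewood–Pólya, *Inequalities*, Theorem 257: «if `y(0) = y(π) = 0`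
and `y′` is `L²`, then `∫₀^π y² dx < ∫₀^π y′² dx` unless `y = C sin x`», proved there through the identity (7.7.3)
`∫₀^π (y′² − y²) = ∫₀^π (y′ − y cot x)²`, the boundary terms `y² cot x` vanishing because `y = o(x^{1/2})` near `0` (Schwarz) and
likewise near `π`. This file proves the non-strict inequality in exactly that generality — `y` continuous on `[0, π]`, differentiable on
the OPEN interval with a derivative continuous there and square-integrable (it may blow up at the ends) — which is what the `C¹(ℝ)`
version in the tree does not cover: §1 the completed square on `[a, b] ⊂ (0, π)` and the passage `a → 0`, `b → π`
(`integral_sq_le_integral_deriv_sq`); §2 the form on `(−π, π)` for `y(−π) = y(0) = y(π) = 0` (two Dirichlet intervals of length `π`;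
`integral_sq_le_integral_deriv_sq_symm`). [cite: HardyLittlewoodPolya1952, Thm. 257 and eq. (7.7.3)]
MOTIVATION (cell ns-blowup, zone Z3, case Z3-SR-CERT, PRICE-impl1 (E5)): with `F(θ) = 𝒰δ(L tan(θ/2))` this is the inequality
`‖𝒰δ‖_{L²(dθ)} ≤ (2L)^{-1/2}‖Hδ‖_w` behind the factor `2/(2L)^{1/2}` of the certificate's high-pass constant `D`, valid exactly under the
endpoint condition `𝒰δ(±∞) = 0` (see `Summits/NavierStokesRegularity/OSWSelfSimilar/SheetRVelocityWirtinger.lean`). No definition.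
-/

noncomputable section

namespace Literature.Analysis.Fourier

open _root_.MeasureTheory _root_.Set _root_.Filter _root_.Real intervalIntegral
open scoped Real Topology

/-! ### §0 Two elementary tools -/

/-- Schwarz against `1` without Hölder machinery: `(∫_a^b f)² ≤ (b − a)·∫_a^b f²` (`a ≤ b`; expand `∫(f − mean)² ≥ 0`) (helper;
the tree has the same lemma under other hypotheses in `CarlemanDichotomy` / `ItoProcessesProofs`). [folklore] -/
private theorem sq_integral_le_mul_integral_sq_aux {f : ℝ → ℝ} {a b : ℝ} (hab : a ≤ b) (hf : IntervalIntegrable f volume a b)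
    (hf2 : IntervalIntegrable (fun x => f x ^ 2) volume a b) :
    (∫ x in a..b, f x) ^ 2 ≤ (b - a) * ∫ x in a..b, f x ^ 2 := by
  rcases hab.eq_or_lt with h | h
  · subst h; simp
  have hba : 0 < b - a := sub_pos.2 h
  set I := ∫ x in a..b, f x with hI
  set m := I / (b - a) with hm
  have hconst : IntervalIntegrable (fun _ : ℝ => m) volume a b := intervalIntegrable_const
  have hfm : IntervalIntegrable (fun x => m * f x) volume a b := hf.const_mul m
  have hkey : 0 ≤ ∫ x in a..b, (f x - m) ^ 2 :=
    intervalIntegral.integral_nonneg h.le fun x _ => sq_nonneg _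
  have hexp : ∫ x in a..b, (f x - m) ^ 2 = (∫ x in a..b, f x ^ 2) - 2 * m * I + m ^ 2 * (b - a) := by
    have e : (fun x => (f x - m) ^ 2) = fun x => f x ^ 2 - 2 * (m * f x) + m ^ 2 := by
      funext x; ring
    rw [e, intervalIntegral.integral_add (hf2.sub (hfm.const_mul 2)) intervalIntegrable_const,
      intervalIntegral.integral_sub hf2 (hfm.const_mul 2), intervalIntegral.integral_const_mul,
      intervalIntegral.integral_const_mul, intervalIntegral.integral_const, smul_eq_mul, hI]
    ring
  rw [hexp, hm] at hkey
  have : 0 ≤ (∫ x in a..b, f x ^ 2) - I ^ 2 / (b - a) := by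
    have e : (∫ x in a..b, f x ^ 2) - 2 * (I / (b - a)) * I + (I / (b - a)) ^ 2 * (b - a) =
        (∫ x in a..b, f x ^ 2) - I ^ 2 / (b - a) := by field_simp; ring
    linarith [e]
  rw [sub_nonneg, div_le_iff₀ hba] at this
  linarith

/-- `a·cos a ≤ sin a` for `0 ≤ a < π/2` (from `a ≤ tan a`), i.e. `a·cot a ≤ 1` (helper). [folklore] -/
private theorem mul_cos_le_sin_aux {a : ℝ} (h0 : 0 ≤ a) (h1 : a < π / 2) : a * Real.cos a ≤ Real.sin a := by
  have hc : 0 < Real.cos a := Real.cos_pos_of_mem_Ioo ⟨by linarith, h1⟩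
  have ht : a ≤ Real.tan a := Real.le_tan h0 h1
  rw [Real.tan_eq_sin_div_cos, le_div_iff₀ hc] at ht
  exact ht

/-! ### §1 Dirichlet–Wirtinger on `(0, π)` -/

/-- The completed square on a compact subinterval: for `0 < a ≤ b < π` and `F ∈ C¹` near `[a,b]`,
`∫_a^b F² ≤ ∫_a^b f² − F(b)²cot b + F(a)²cot a` (`f = F′`; from `f² = F² + (f − F cot θ)² + (F²cot θ)′`).
[cite: HardyLittlewoodPolya1952, §7.7 eq. (7.7.3)] -/
theorem integral_sq_le_integral_deriv_sq_core {F f : ℝ → ℝ} {a b : ℝ} (ha : 0 < a) (hab : a ≤ b) (hb : b < π)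
    (hF : ∀ θ ∈ Icc a b, HasDerivAt F (f θ) θ) (hfc : ContinuousOn f (Icc a b)) :
    ∫ θ in a..b, F θ ^ 2 ≤ (∫ θ in a..b, f θ ^ 2) - F b ^ 2 * (Real.cos b / Real.sin b) +
      F a ^ 2 * (Real.cos a / Real.sin a) := by
  have hsin : ∀ θ ∈ Icc a b, 0 < Real.sin θ := fun θ hθ =>
    Real.sin_pos_of_pos_of_lt_pi (by linarith [hθ.1]) (by linarith [hθ.2])
  have hFc : ContinuousOn F (Icc a b) := fun θ hθ => (hF θ hθ).continuousAt.continuousWithinAt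
  -- the primitive `G = F² cot` and its derivative
  set g : ℝ → ℝ := fun θ => 2 * F θ * f θ * (Real.cos θ / Real.sin θ) - F θ ^ 2 / Real.sin θ ^ 2 with hg
  have hG : ∀ θ ∈ uIcc a b, HasDerivAt (fun θ => F θ ^ 2 * (Real.cos θ / Real.sin θ)) (g θ) θ := by
    intro θ hθ
    rw [uIcc_of_le hab] at hθ
    have hs := (hsin θ hθ).ne'
    have hcot : HasDerivAt (fun θ => Real.cos θ / Real.sin θ) (-1 / Real.sin θ ^ 2) θ := by
      have h := (Real.hasDerivAt_cos θ).div (Real.hasDerivAt_sin θ) hs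
      refine h.congr_deriv ?_
      field_simp
      nlinarith [Real.sin_sq_add_cos_sq θ]
    have h := ((hF θ hθ).fun_pow 2).fun_mul hcot
    refine h.congr_deriv ?_
    simp only [hg]
    push_cast
    field_simp
    ring
  have hcotc : ContinuousOn (fun θ => Real.cos θ / Real.sin θ) (Icc a b) :=
    Real.continuous_cos.continuousOn.div Real.continuous_sin.continuousOn fun θ hθ => (hsin θ hθ).ne'
  have hgc : ContinuousOn g (uIcc a b) := by
    rw [uIcc_of_le hab]
    refine ((((continuousOn_const.mul hFc).mul hfc).mul hcotc).sub
      ((hFc.pow 2).div (Real.continuous_sin.continuousOn.pow 2) fun θ hθ => ?_))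
    exact pow_ne_zero 2 (hsin θ hθ).ne'
  have hFTC := intervalIntegral.integral_eq_sub_of_hasDerivAt hG (hgc.intervalIntegrable)
  -- pointwise identity `f² = F² + (f − F cot)² + g`
  have hpt : ∀ θ ∈ Icc a b, f θ ^ 2 = F θ ^ 2 + (f θ - F θ * (Real.cos θ / Real.sin θ)) ^ 2 + g θ := by
    intro θ hθ
    have hs := (hsin θ hθ).ne'
    simp only [hg]
    field_simp
    nlinarith [Real.sin_sq_add_cos_sq θ]
  have hIf2 : IntervalIntegrable (fun θ => f θ ^ 2) volume a b := by
    rw [← uIcc_of_le hab] at hfc; exact (hfc.pow 2).intervalIntegrable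
  have hIF2 : IntervalIntegrable (fun θ => F θ ^ 2) volume a b := by
    rw [← uIcc_of_le hab] at hFc; exact (hFc.pow 2).intervalIntegrable
  have hIsq : IntervalIntegrable (fun θ => (f θ - F θ * (Real.cos θ / Real.sin θ)) ^ 2) volume a b := by
    rw [← uIcc_of_le hab] at hfc hFc hcotc
    exact ((hfc.sub (hFc.mul hcotc)).pow 2).intervalIntegrable
  have heq : ∫ θ in a..b, f θ ^ 2 = (∫ θ in a..b, F θ ^ 2) +
      (∫ θ in a..b, (f θ - F θ * (Real.cos θ / Real.sin θ)) ^ 2) + ∫ θ in a..b, g θ := by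
    rw [← intervalIntegral.integral_add hIF2 hIsq, ← intervalIntegral.integral_add (hIF2.add hIsq) hgc.intervalIntegrable]
    refine intervalIntegral.integral_congr fun θ hθ => ?_
    rw [uIcc_of_le hab] at hθ
    exact hpt θ hθ
  have hnn : 0 ≤ ∫ θ in a..b, (f θ - F θ * (Real.cos θ / Real.sin θ)) ^ 2 :=
    intervalIntegral.integral_nonneg hab fun θ _ => sq_nonneg _
  rw [heq, hFTC]
  linarith

/-- **Dirichlet–Wirtinger on `(0, π)`** (sharp constant `1`): if `F` is continuous on `[0, π]`, differentiable on `(0, π)` with a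
derivative `f` continuous there, `f` and `f²` integrable on `(0, π)`, and `F(0) = F(π) = 0`, then `∫₀^π F² ≤ ∫₀^π f²`
(Hardy–Littlewood–Pólya's Theorem 257, non-strict form). [cite: HardyLittlewoodPolya1952, Thm. 257] -/
theorem integral_sq_le_integral_deriv_sq {F f : ℝ → ℝ} (hF : ∀ θ ∈ Ioo 0 π, HasDerivAt F (f θ) θ)
    (hFc : ContinuousOn F (Icc 0 π)) (hfc : ContinuousOn f (Ioo 0 π)) (hf1 : IntervalIntegrable f volume 0 π)
    (hf2 : IntervalIntegrable (fun θ => f θ ^ 2) volume 0 π) (hF0 : F 0 = 0) (hFπ : F π = 0) :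
    ∫ θ in (0:ℝ)..π, F θ ^ 2 ≤ ∫ θ in (0:ℝ)..π, f θ ^ 2 := by
  have hπ : 0 < π := Real.pi_pos
  -- sub-interval integrability helpers
  have hsub1 : ∀ {c d : ℝ}, 0 ≤ c → c ≤ d → d ≤ π → IntervalIntegrable f volume c d := fun hc hcd hd =>
    hf1.mono_set (by rw [uIcc_of_le hπ.le, uIcc_of_le hcd]; exact Icc_subset_Icc hc hd)
  have hsub2 : ∀ {c d : ℝ}, 0 ≤ c → c ≤ d → d ≤ π → IntervalIntegrable (fun θ => f θ ^ 2) volume c d :=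
    fun hc hcd hd => hf2.mono_set (by rw [uIcc_of_le hπ.le, uIcc_of_le hcd]; exact Icc_subset_Icc hc hd)
  -- (A) left endpoint: `F(a)²cot a ≤ ∫₀^a f²` for `0 < a < π/2`
  have hA : ∀ a, 0 < a → a < π / 2 → F a ^ 2 * (Real.cos a / Real.sin a) ≤ ∫ θ in (0:ℝ)..a, f θ ^ 2 := by
    intro a ha0 ha1
    have haπ : a ≤ π := by linarith
    have hsa : 0 < Real.sin a := Real.sin_pos_of_pos_of_lt_pi ha0 (by linarith)
    have hFa : F a = ∫ θ in (0:ℝ)..a, f θ := by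
      have h := intervalIntegral.integral_eq_sub_of_hasDerivAt_of_le ha0.le (hFc.mono (Icc_subset_Icc le_rfl haπ))
        (fun θ hθ => hF θ ⟨hθ.1, by linarith [hθ.2]⟩) (hsub1 le_rfl ha0.le haπ)
      rw [h, hF0, sub_zero]
    have hcs := sq_integral_le_mul_integral_sq_aux ha0.le (hsub1 le_rfl ha0.le haπ) (hsub2 le_rfl ha0.le haπ)
    rw [sub_zero] at hcs
    have hI : 0 ≤ ∫ θ in (0:ℝ)..a, f θ ^ 2 := intervalIntegral.integral_nonneg ha0.le fun θ _ => sq_nonneg _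
    have hcot : a * (Real.cos a / Real.sin a) ≤ 1 := by
      rw [← mul_div_assoc, div_le_one hsa]; exact mul_cos_le_sin_aux ha0.le ha1
    have hcot0 : 0 ≤ Real.cos a / Real.sin a :=
      div_nonneg (Real.cos_nonneg_of_mem_Icc ⟨by linarith, by linarith⟩) hsa.le
    calc F a ^ 2 * (Real.cos a / Real.sin a) ≤ (a * ∫ θ in (0:ℝ)..a, f θ ^ 2) * (Real.cos a / Real.sin a) := by
          rw [hFa]; exact mul_le_mul_of_nonneg_right hcs hcot0
      _ = (a * (Real.cos a / Real.sin a)) * ∫ θ in (0:ℝ)..a, f θ ^ 2 := by ring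
      _ ≤ 1 * ∫ θ in (0:ℝ)..a, f θ ^ 2 := mul_le_mul_of_nonneg_right hcot hI
      _ = _ := one_mul _
  -- (B) right endpoint: `−F(b)²cot b ≤ ∫_b^π f²` for `π/2 < b < π`
  have hB : ∀ b, π / 2 < b → b < π → -(F b ^ 2 * (Real.cos b / Real.sin b)) ≤ ∫ θ in b..π, f θ ^ 2 := by
    intro b hb0 hb1
    have hbpos : 0 ≤ b := by linarith
    have hsb : 0 < Real.sin b := Real.sin_pos_of_pos_of_lt_pi (by linarith) hb1
    have hFb : F b = -∫ θ in b..π, f θ := by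
      have h := intervalIntegral.integral_eq_sub_of_hasDerivAt_of_le hb1.le (hFc.mono (Icc_subset_Icc hbpos le_rfl))
        (fun θ hθ => hF θ ⟨by linarith [hθ.1], hθ.2⟩) (hsub1 hbpos hb1.le le_rfl)
      rw [h, hFπ, zero_sub, neg_neg]
    have hcs := sq_integral_le_mul_integral_sq_aux hb1.le (hsub1 hbpos hb1.le le_rfl) (hsub2 hbpos hb1.le le_rfl)
    have hI : 0 ≤ ∫ θ in b..π, f θ ^ 2 := intervalIntegral.integral_nonneg hb1.le fun θ _ => sq_nonneg _
    -- with `c = π − b ∈ (0, π/2)`: `−cot b = cot c`, `c·cot c ≤ 1`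
    have hc0 : 0 < π - b := by linarith
    have hc1 : π - b < π / 2 := by linarith
    have hcosb : Real.cos b = -Real.cos (π - b) := by rw [Real.cos_pi_sub]; ring
    have hsinb : Real.sin b = Real.sin (π - b) := by rw [Real.sin_pi_sub]
    have hsc : 0 < Real.sin (π - b) := by rwa [← hsinb]
    have hcot : (π - b) * (Real.cos (π - b) / Real.sin (π - b)) ≤ 1 := by
      rw [← mul_div_assoc, div_le_one hsc]; exact mul_cos_le_sin_aux hc0.le hc1
    have hcot0 : 0 ≤ Real.cos (π - b) / Real.sin (π - b) :=
      div_nonneg (Real.cos_nonneg_of_mem_Icc ⟨by linarith, by linarith⟩) hsc.le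
    rw [hcosb, hsinb, show -(F b ^ 2 * (-Real.cos (π - b) / Real.sin (π - b))) =
      F b ^ 2 * (Real.cos (π - b) / Real.sin (π - b)) by ring]
    calc F b ^ 2 * (Real.cos (π - b) / Real.sin (π - b))
        ≤ ((π - b) * ∫ θ in b..π, f θ ^ 2) * (Real.cos (π - b) / Real.sin (π - b)) := by
          rw [hFb, neg_sq]; exact mul_le_mul_of_nonneg_right hcs hcot0
      _ = ((π - b) * (Real.cos (π - b) / Real.sin (π - b))) * ∫ θ in b..π, f θ ^ 2 := by ring
      _ ≤ 1 * ∫ θ in b..π, f θ ^ 2 := mul_le_mul_of_nonneg_right hcot hI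
      _ = _ := one_mul _
  -- (C) for `0 < a < π/2 < b < π`: `∫_a^b F² ≤ ∫_0^π f²`
  have hC : ∀ a b, 0 < a → a < π / 2 → π / 2 < b → b < π → ∫ θ in a..b, F θ ^ 2 ≤ ∫ θ in (0:ℝ)..π, f θ ^ 2 := by
    intro a b ha0 ha1 hb0 hb1
    have hab : a ≤ b := by linarith
    have hcore := integral_sq_le_integral_deriv_sq_core ha0 hab hb1 (fun θ hθ => hF θ ⟨by linarith [hθ.1], by linarith [hθ.2]⟩)
      (hfc.mono fun θ hθ => ⟨by linarith [hθ.1], by linarith [hθ.2]⟩)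
    have hsplit : ∫ θ in (0:ℝ)..π, f θ ^ 2 =
        (∫ θ in (0:ℝ)..a, f θ ^ 2) + (∫ θ in a..b, f θ ^ 2) + ∫ θ in b..π, f θ ^ 2 := by
      rw [intervalIntegral.integral_add_adjacent_intervals (hsub2 le_rfl ha0.le (by linarith)) (hsub2 ha0.le hab hb1.le),
        intervalIntegral.integral_add_adjacent_intervals (hsub2 le_rfl (by linarith) hb1.le) (hsub2 (by linarith) hb1.le le_rfl)]
    linarith [hA a ha0 ha1, hB b hb0 hb1]
  -- (D) let `a → 0`, `b → π`
  obtain ⟨M, hM⟩ : ∃ M, ∀ θ ∈ Icc 0 π, F θ ^ 2 ≤ M := by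
    obtain ⟨M, hM⟩ := (isCompact_Icc.image_of_continuousOn (hFc.pow 2)).isBounded.bddAbove
    exact ⟨M, fun θ hθ => hM ⟨θ, hθ, rfl⟩⟩
  have hM0 : 0 ≤ M := le_trans (sq_nonneg (F 0)) (hM 0 ⟨le_rfl, hπ.le⟩)
  have hIF2 : ∀ {c d : ℝ}, 0 ≤ c → c ≤ d → d ≤ π → IntervalIntegrable (fun θ => F θ ^ 2) volume c d :=
    fun hc hcd hd => ((hFc.pow 2).mono (by rw [uIcc_of_le hcd]; exact Icc_subset_Icc hc hd)).intervalIntegrable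
  have hsmall : ∀ {c d : ℝ}, 0 ≤ c → c ≤ d → d ≤ π → ∫ θ in c..d, F θ ^ 2 ≤ M * (d - c) := by
    intro c d hc hcd hd
    have h := intervalIntegral.norm_integral_le_of_norm_le_const (a := c) (b := d) (C := M) (f := fun θ => F θ ^ 2)
      (fun θ hθ => by
        rw [uIoc_of_le hcd] at hθ
        rw [Real.norm_eq_abs, abs_of_nonneg (sq_nonneg _)]
        exact hM θ ⟨le_trans hc hθ.1.le, le_trans hθ.2 hd⟩)
    rw [Real.norm_eq_abs, abs_of_nonneg (intervalIntegral.integral_nonneg hcd fun θ _ => sq_nonneg _),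
      abs_of_nonneg (sub_nonneg.2 hcd)] at h
    exact h
  refine le_of_forall_pos_le_add fun ε hε => ?_
  -- choose `a = min(π/4, ε/(2(M+1)))`, `b = π − a`
  set a : ℝ := min (π / 4) (ε / (2 * (M + 1))) with ha_def
  have ha0 : 0 < a := lt_min (by positivity) (by positivity)
  have ha1 : a < π / 2 := lt_of_le_of_lt (min_le_left _ _) (by linarith)
  have haε : M * a ≤ ε / 2 := by
    have h1 : a ≤ ε / (2 * (M + 1)) := min_le_right _ _
    have h2 : M * a ≤ M * (ε / (2 * (M + 1))) := mul_le_mul_of_nonneg_left h1 hM0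
    have h3 : M * (ε / (2 * (M + 1))) ≤ ε / 2 := by
      rw [mul_div_assoc']
      rw [div_le_div_iff₀ (by positivity) (by positivity)]
      nlinarith
    linarith
  have hb0 : π / 2 < π - a := by linarith
  have hb1 : π - a < π := by linarith
  have hsplit : ∫ θ in (0:ℝ)..π, F θ ^ 2 =
      (∫ θ in (0:ℝ)..a, F θ ^ 2) + (∫ θ in a..(π - a), F θ ^ 2) + ∫ θ in (π - a)..π, F θ ^ 2 := by
    rw [intervalIntegral.integral_add_adjacent_intervals (hIF2 le_rfl ha0.le (by linarith)) (hIF2 ha0.le (by linarith) hb1.le),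
      intervalIntegral.integral_add_adjacent_intervals (hIF2 le_rfl (by linarith) hb1.le) (hIF2 (by linarith) hb1.le le_rfl)]
  have h1 := hsmall le_rfl ha0.le (by linarith : a ≤ π)
  have h2 := hsmall (by linarith : 0 ≤ π - a) hb1.le le_rfl
  have h3 := hC a (π - a) ha0 ha1 hb0 hb1
  rw [sub_zero] at h1
  rw [show π - (π - a) = a by ring] at h2
  linarith

/-! ### §2 The symmetric interval `(−π, π)` with `F(−π) = F(0) = F(π) = 0` -/

/-- **Dirichlet–Wirtinger on `(−π, π)` through the origin**: `F` continuous on `[−π, π]`, differentiable on `(−π, π)` with derivative `f`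
continuous there, `f, f² ∈ L¹`, and `F(−π) = F(0) = F(π) = 0` ⇒ `∫_{−π}^{π} F² ≤ ∫_{−π}^{π} f²` (constant `1`: two Dirichlet intervals
of length `π`, Theorem 257 on each). [cite: HardyLittlewoodPolya1952, Thm. 257] -/
theorem integral_sq_le_integral_deriv_sq_symm {F f : ℝ → ℝ} (hF : ∀ θ ∈ Ioo (-π) π, HasDerivAt F (f θ) θ)
    (hFc : ContinuousOn F (Icc (-π) π)) (hfc : ContinuousOn f (Ioo (-π) π)) (hf1 : IntervalIntegrable f volume (-π) π)
    (hf2 : IntervalIntegrable (fun θ => f θ ^ 2) volume (-π) π) (hFm : F (-π) = 0) (hF0 : F 0 = 0) (hFπ : F π = 0) :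
    ∫ θ in (-π)..π, F θ ^ 2 ≤ ∫ θ in (-π)..π, f θ ^ 2 := by
  have hπ : 0 < π := Real.pi_pos
  have hsubR : uIcc (0:ℝ) π ⊆ uIcc (-π) π := by
    rw [uIcc_of_le hπ.le, uIcc_of_le (by linarith)]; exact Icc_subset_Icc (by linarith) le_rfl
  have hsubL : uIcc (-π) (0:ℝ) ⊆ uIcc (-π) π := by
    rw [uIcc_of_le (by linarith : (-π:ℝ) ≤ 0), uIcc_of_le (by linarith)]; exact Icc_subset_Icc le_rfl hπ.le
  -- right half
  have hR : ∫ θ in (0:ℝ)..π, F θ ^ 2 ≤ ∫ θ in (0:ℝ)..π, f θ ^ 2 :=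
    integral_sq_le_integral_deriv_sq (fun θ hθ => hF θ ⟨by linarith [hθ.1], hθ.2⟩)
      (hFc.mono (Icc_subset_Icc (by linarith) le_rfl)) (hfc.mono fun θ hθ => ⟨by linarith [hθ.1], hθ.2⟩)
      (hf1.mono_set hsubR) (hf2.mono_set hsubR) hF0 hFπ
  -- left half, by reflection `θ ↦ −θ`
  have hL : ∫ θ in (0:ℝ)..π, F (-θ) ^ 2 ≤ ∫ θ in (0:ℝ)..π, (-f (-θ)) ^ 2 := by
    refine integral_sq_le_integral_deriv_sq (F := fun θ => F (-θ)) (f := fun θ => -f (-θ)) ?_ ?_ ?_ ?_ ?_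
      (by simpa using hF0) (by simpa using hFm)
    · intro θ hθ
      have h := (hF (-θ) ⟨by linarith [hθ.2], by linarith [hθ.1]⟩).comp θ (hasDerivAt_neg θ)
      simpa [Function.comp_def] using h
    · exact hFc.comp continuous_neg.continuousOn fun θ hθ => ⟨by linarith [hθ.2], by linarith [hθ.1]⟩
    · exact (hfc.comp continuous_neg.continuousOn fun θ hθ => ⟨by linarith [hθ.2], by linarith [hθ.1]⟩).neg
    · have h := (IntervalIntegrable.iff_comp_neg (f := f)).mp (hf1.mono_set hsubL)
      simp only [neg_neg, neg_zero] at h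
      exact h.symm.neg
    · have h := (IntervalIntegrable.iff_comp_neg (f := fun θ => f θ ^ 2)).mp (hf2.mono_set hsubL)
      simp only [neg_neg, neg_zero] at h
      refine h.symm.congr fun θ _ => ?_
      simp only [neg_sq]
  have hL' : ∫ θ in (-π)..(0:ℝ), F θ ^ 2 ≤ ∫ θ in (-π)..(0:ℝ), f θ ^ 2 := by
    have e1 : ∫ θ in (0:ℝ)..π, F (-θ) ^ 2 = ∫ θ in (-π)..(0:ℝ), F θ ^ 2 := by
      rw [intervalIntegral.integral_comp_neg (fun θ => F θ ^ 2)]; simp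
    have e2 : ∫ θ in (0:ℝ)..π, (-f (-θ)) ^ 2 = ∫ θ in (-π)..(0:ℝ), f θ ^ 2 := by
      simp only [neg_sq]
      rw [intervalIntegral.integral_comp_neg (fun θ => f θ ^ 2)]; simp
    rw [← e1, ← e2]; exact hL
  have hIF : IntervalIntegrable (fun θ => F θ ^ 2) volume (-π) π :=
    ((hFc.pow 2).mono (by rw [uIcc_of_le (by linarith)])).intervalIntegrable
  rw [← intervalIntegral.integral_add_adjacent_intervals (hIF.mono_set hsubL) (hIF.mono_set hsubR),
    ← intervalIntegral.integral_add_adjacent_intervals (hf2.mono_set hsubL) (hf2.mono_set hsubR)]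
  linarith

end Literature.Analysis.Fourier
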